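import Summits.BirchSwinnertonDyer.BirchSwinnertonDyer.Theorems.SignedLowerHalvesSmallImageLowerHalfBothSignsRttJunctionShaSemilocTwoMap
import Summits.BirchSwinnertonDyer.BirchSwinnertonDyer.Theorems.SignedLowerHalvesSmallImageLowerHalfBothSignsRttJunctionShaLocBounded
import HarnessLib

/-!
# Route `SignedLowerHalves`, crux L `SmallImageLowerHalfBothSigns` (stmt-BirchSwinnertonDyer-23599), line `rtt_w3` v30 — stub S3α′ (`stub_junctionShaPT_ns`):
# ★★★ THE `ρ`-HALF OF THE REGISTERED WITNESS — a `Λ`-LINEAR `ρ₂ : I₂.H → Loc` (for the stub's `letI := I₂.moduleIwasawa`) with `Loc` FINITE as soon as the semilocal levels at the places of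
# `S₀` are uniformly bounded, and whose kernel is EXACTLY the classes all of whose degree-2 semilocalisations vanish (what the Poitou–Tate map `π` of α5′ must cover)

INPUTS hand `bsd-inputs-honda-p1` g28 under LEAD `cruxlead-stmt-BirchSwinnertonDyer-23599` g14 (cell `bsd-ssimc`); helper `--supports stmt-BirchSwinnertonDyer-23599`. THEOREMS ONLY.
WHY. The registered S3α′ concludes `∃ (Loc) (_ : AddCommGroup Loc) (_ : Module Λ Loc) (_ : Finite Loc) (ρ : I₂.H →ₗ[Λ] Loc) (π : Y′ →ₗ[Λ] I₂.H), ker ρ ≤ range π` under `letI := I₂.moduleIwasawa`.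
This file packages the `ρ`-half ONCE in that currency: `exists_rhoTwo` gives `Loc := Π_{w : S₀} (L₂ w).H` for -w3's CONSTRUCTED degree-2 semilocal data with the componentwise restriction-of-scalars
`Λ`-structure, `ρ := ρ₂ = semilocMapPi₂` (p814071) read `Λ`-linearly, (i) the KERNEL CRITERION `ρ b = 0 ↔ ∀ w ∈ S₀, ∀ n k, sloc²_{w,n,k}(proj n k b) = 0` and (ii) `Finite Loc` from uniformly bounded
levels at every `w ∈ S₀` (LEAD g14 `finite_pi_semiloc_of_levels`, p813183; the bounds: honda g28 `…RttJunctionShaLocCount*`). With it the stub is EXACTLY α5′: a `Λ`-linear `π : Y′ → I₂.H`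
whose range contains every class with vanishing degree-2 semilocalisations at `S₀ = supp(p𝔣)`, plus the levelwise bound at `vp`.
HONEST FRAMING: packaging; nothing about S3α′, E2, crux L or BSD is proved; all remain OPEN and are proved for NO curve.
References: [NeukirchSchmidtWingberg2008] (8.6.3), (8.6.10); [Rubin2000] Thm. 1.7.3, App. B.3; [PerrinRiou1994Invent] §1.3.
-/

set_option autoImplicit false
set_option linter.dupNamespace false -- D-0017: single-problem summit, the namespace repeats the problem name by design
noncomputable section

open scoped Classical
open NumberField IsDedekindDomain Field CategoryTheory Function

namespace Summit.BirchSwinnertonDyer.BirchSwinnertonDyer.Theorems.SmallImageRttJunctionSha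

open Literature.NumberTheory.EllipticCurves Literature.NumberTheory.GaloisRepresentations
  Literature.NumberTheory.ComplexMultiplication.EllipticUnits.JohnsonLeungKings2011
  Summit.BirchSwinnertonDyer.BirchSwinnertonDyer.Theorems.SmallImageRttD2J1
  Summit.BirchSwinnertonDyer.BirchSwinnertonDyer.Theorems.SmallImageRttD2Seq

section Rho

variable {K : Type} [Field K] [NumberField K] {p : ℕ} [Fact p.Prime] {S : Set (PadicAlgCl p)} {κ : ZpExtension K p} {γ : absoluteGaloisGroup K}
  {θ' : absoluteGaloisGroup K →ₜ* (padicCoeffIntegers S)ˣ} {P : Set (HeightOneSpectrum (𝓞 K))}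
  (hNP : ∀ n, ramificationSubgroup K P ≤ κ.layerSubgroup n) (S₀ : Set (HeightOneSpectrum (𝓞 K)))
  (I : CycIwasawaCohomologyDataO S κ γ θ' P 2)

include hNP in
/-- ★★★ **THE `ρ`-HALF OF S3α′'s WITNESS, `Λ`-LINEARLY**: there are a `Λ`-module `Loc` and a `Λ`-linear `ρ : I₂.H → Loc` (for `I₂.moduleIwasawa`) such that (i) `ρ b = 0` iff every degree-2
semilocalisation `sloc²_{w,n,k}(proj n k b)`, `w ∈ S₀`, vanishes, and (ii) `Loc` is finite whenever, at every `w ∈ S₀`, the semilocal levels `H²(Γ_{K_w}, Maps(Γ_K ⧸ U_n, X_k))` are finite and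
uniformly bounded and `S₀` is finite. (`Loc := Π_{w : S₀} (L₂ w).H` for the constructed data, `ρ := ρ₂`.) [cite: NeukirchSchmidtWingberg2008, (8.6.3), (8.6.10)] [cite: Rubin2000, App. B.3] -/
theorem exists_rhoTwo :
    letI := I.moduleIwasawa
    ∃ (Loc : Type) (_ : AddCommGroup Loc) (_ : Module (IwasawaAlgebra p) Loc) (ρ : I.H →ₗ[IwasawaAlgebra p] Loc),
      (∀ b : I.H, ρ b = 0 ↔ ∀ w ∈ S₀, ∀ n k, semilocNKq S κ θ' P w 2 n k (I.proj n k b) = 0) ∧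
      (S₀.Finite → (∀ w ∈ S₀, (∀ n k, Finite (semilocCoh S κ θ' P w n k 2)) ∧ ∃ B : ℕ, ∀ n k, Nat.card (semilocCoh S κ θ' P w n k 2) ≤ B) → Finite Loc) := by
  letI := I.moduleIwasawa
  let L : ∀ w : HeightOneSpectrum (𝓞 K), SemilocIwasawaCohomologyDataO S κ γ θ' P w 2 := fun w ↦ semilocIwasawaCohomologyDataO S κ γ θ' P w 2
  letI : ∀ w : HeightOneSpectrum (𝓞 K), Module (IwasawaAlgebra p) (L w).H := fun w ↦ (L w).moduleIwasawa
  refine ⟨(∀ w : S₀, (L w).H), inferInstance, inferInstance,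
    { toFun := semilocMapPi₂ hNP S₀ I L
      map_add' := fun b b' ↦ map_add _ b b'
      map_smul' := fun g b ↦ ?_ }, fun b ↦ ?_, fun hS₀ hB ↦ ?_⟩
  · -- `Λ` acts through `iwasawaToIwasawaO S` on both sides
    change semilocMapPi₂ hNP S₀ I L (iwasawaToIwasawaO S g • b) = _
    rw [map_smul]
    rfl
  · change semilocMapPi₂ hNP S₀ I L b = 0 ↔ _
    rw [← LinearMap.mem_ker, mem_ker_semilocMapPi₂_iff]
  · haveI : Finite S₀ := hS₀.to_subtype
    haveI : ∀ w : S₀, Finite (L w).H := fun w ↦ by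
      obtain ⟨B, hBw⟩ := (hB w w.2).2
      exact ((L w).finite_and_natCard_le_of_levels (hB w w.2).1 hBw).1
    change Finite (∀ w : S₀, (L w).H)
    infer_instance

include hNP in
/-- The same with the LOCAL description of the kernel (part 1 `semilocNK₂_eq_zero_iff`): `ρ b = 0` iff every localisation `loc²_{n,w}(conj_δ (proj n k b))` at every place of every layer above
`S₀` vanishes — the form the tower Poitou–Tate map of α5′ consumes. [cite: NeukirchSchmidtWingberg2008, I §5 (1.5.6)–(1.5.7), (8.6.3), (8.6.10)] -/
theorem exists_rhoTwo_loc :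
    letI := I.moduleIwasawa
    ∃ (Loc : Type) (_ : AddCommGroup Loc) (_ : Module (IwasawaAlgebra p) Loc) (ρ : I.H →ₗ[IwasawaAlgebra p] Loc),
      (∀ b : I.H, ρ b = 0 ↔ ∀ w ∈ S₀, ∀ (n k : ℕ) (δ : absoluteGaloisGroup K),
        ContinuousCohomology.map (locLayerHom κ P w n) (locLayerMod S κ θ' P w n k) 2 (cycLayerConjO S κ θ' P n k 2 δ (I.proj n k b)) = 0) ∧
      (S₀.Finite → (∀ w ∈ S₀, (∀ n k, Finite (semilocCoh S κ θ' P w n k 2)) ∧ ∃ B : ℕ, ∀ n k, Nat.card (semilocCoh S κ θ' P w n k 2) ≤ B) → Finite Loc) := by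
  obtain ⟨Loc, i1, i2, ρ, hker, hfin⟩ := exists_rhoTwo hNP S₀ I
  refine ⟨Loc, i1, i2, ρ, fun b ↦ ?_, hfin⟩
  rw [hker b]
  refine forall_congr' fun w ↦ forall_congr' fun _ ↦ forall_congr' fun n ↦ forall_congr' fun k ↦ ?_
  rw [semilocNK₂_eq_zero_iff]

end Rho

end Summit.BirchSwinnertonDyer.BirchSwinnertonDyer.Theorems.SmallImageRttJunctionSha

end
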